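import Summits.QuantumFields.BalabanUV.Beta.GAN24.TableDressingProjector

/-!
# `BalabanUV.Beta.GAN24.TableDressingIdempotent` — binder row G-an2-4 ∕ (CONV-C), CT-W: **THE TABLE DRESSING `𝔇` IS A PROJECTOR** — the four one-variable dressings commute
# pairwise (finite window sums in different variables) and are each idempotent (`TableDressingProjector`), so `𝔇 ∘ 𝔇 = 𝔇`; hence **the dressed linear step sees only the
# dressed table: `lin4 c (Πᵀ K Π) N (𝔇 X) = lin4 c (Πᵀ K Π) N X` and `lin4 c (Πᵀ K Π) N (𝔇 X − X) = 0`**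

NOT IN PRINT; OUR BOOKKEEPING (G-an2-4 crux team (2), leaf prover `b2b-balaban-gan24-formalise-leaf-06`, gen 43; PART 3b of journal INTENT [GAN24LEAF06-G43-INTENT3]).
HONEST FRAMING (cell contract, verbatim): «discharging `BetaPertH` makes Bałaban's UV stability UNCONDITIONAL — a real constructive-QFT result; it is NOT the
continuum limit and NOT the Clay problem.»  HONEST DEPENDENCY (verbatim): «continuum YM on T⁴ ⇐ BetaPertH ∧ nine spine estimates (0/9 proved); BetaPertH ⇐
(D1) ∧ (D4) ∧ CAP+tail; G-an2-4 gates asym, D1 and NE2/3/4.»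

WHAT ([folklore]; `P₂, P₁, L₁, L₂` the lambdas of `TableDressingDefect.tableDress_eq_legs`; any root offset and any `N` for §1, in-block root and `1 ≤ N` from §2 on;
0 `def`, 0 cite, 0 `def … : Prop`, 0 sorry):
§1 `sum_comm₄` and the six commutations `coProj_snd_fst_comm`, `coProj_snd_legCo₁_comm`, `coProj_snd_legCo₂_comm`, `coProj_fst_legCo₁_comm`, `coProj_fst_legCo₂_comm`,
   `legCo₁_legCo₂_comm` (pointwise exchanges of two finite window sums).
§2 **`tableDress_idem`**: `𝔇 (𝔇 X) = 𝔇 X`.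
§4 `tableDress_div_snd ∕ _fst ∕ _leg₁ ∕ _leg₂_blockConst` — every `𝔇`-image has BLOCK-CONSTANT divergence in each of its four variables (the converse of
   `TableDressingProjector.tableDress_eq_self_of_blockConst_div`: Im `𝔇` = {four slot divergences block-constant}).
§3 **`lin4_coDressKBmAt_tableDress`**: `lin4 c (coDressKBmAt ρ N K) N (𝔇 X) = lin4 c (coDressKBmAt ρ N K) N X` (decaying `K`, `LocStencil₂` table at the same rate) and
   **`lin4_coDressKBmAt_defect_eq_zero`**: `lin4 c (coDressKBmAt ρ N K) N (𝔇 X − X) = 0` — the dressed step annihilates every `(𝔇 − 1)`-defect; WLOG the input of a dressed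
   composite is a `𝔇`-image (whose slot divergences are block means, `TableDressingProjector` §2).
Asserts NOTHING about Bałaban's tables; 0 estimate; NEVER «G-an2-4 closed» as (CONV-C); NOT D1, NOT `BetaPertH`, NOT continuum, NOT Clay.  2026-08-22.
-/

noncomputable section

open Finset
open scoped BigOperators
open Literature.MathematicalPhysics.QuantumFieldTheory
open Literature.MathematicalPhysics.QuantumFieldTheory.Balaban1983to89
open Literature.MathematicalPhysics.QuantumFieldTheory.Balaban1983to89.Beta
open ExpKernelCalculus (MKer Site Decays)
open AffineAveraging (box toSite unitVec)
open AveragingContours (blk)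
open OneStepResolventKernel (Fib)
open BalabanCompositeJets (LocStencil₂)
open Summit.QuantumFields.BalabanUV.Beta.AxialDressingRooted (cube pmBm coProjBmAt coProjBmAt_apply coProjBmAtK coProjBmAtK_eval coDressKBmAt dressKBmAt
  legCo₁BmAt legCo₂BmAt legCo₁BmAt_inl legCo₁BmAt_inr legCo₂BmAt_inl legCo₂BmAt_inr dressKBmAt_eq_legs cKb cKb_nonneg cWb cWb_nonneg)
open Summit.QuantumFields.BalabanUV.Beta.GAN24.BiStencilZeroMode (Tab)
open Summit.QuantumFields.BalabanUV.Beta.GAN24.T2RecursionAffine (lin4)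
open Summit.QuantumFields.BalabanUV.Beta.GAN24.LinT2CoDressed (lin4_coDressKBmAt)
open Summit.QuantumFields.BalabanUV.Beta.GAN24.Lin4Additive (lin4_sub)
open Summit.QuantumFields.BalabanUV.Beta.GAN24.TableDressingDefect (tableDress_eq_legs locStencil₂_tableDress bdd_of_locStencil₂)
open Summit.QuantumFields.BalabanUV.Beta.GAN24.TableDressingProjector (coProj_snd_idem coProj_fst_idem legCo₁_idem legCo₂_idem)

namespace Summit.QuantumFields.BalabanUV.Beta.GAN24.TableDressingIdempotent

variable {d : ℕ}

/-! ## §1 The four one-variable dressings commute pairwise -/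

/-- [folklore] Exchange of two finite double sums: `Σ_v Σ_β Σ_v′ Σ_γ f = Σ_v′ Σ_γ Σ_v Σ_β f`. -/
theorem sum_comm₄ {ι κ : Type*} (s t : Finset ι) [Fintype κ] (f : ι → κ → ι → κ → ℝ) :
    ∑ v ∈ s, ∑ β : κ, ∑ v' ∈ t, ∑ γ : κ, f v β v' γ = ∑ v' ∈ t, ∑ γ : κ, ∑ v ∈ s, ∑ β : κ, f v β v' γ := by
  calc ∑ v ∈ s, ∑ β : κ, ∑ v' ∈ t, ∑ γ : κ, f v β v' γ
      = ∑ v ∈ s, ∑ v' ∈ t, ∑ β : κ, ∑ γ : κ, f v β v' γ := Finset.sum_congr rfl fun v _ => Finset.sum_comm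
    _ = ∑ v' ∈ t, ∑ v ∈ s, ∑ β : κ, ∑ γ : κ, f v β v' γ := Finset.sum_comm
    _ = ∑ v' ∈ t, ∑ v ∈ s, ∑ γ : κ, ∑ β : κ, f v β v' γ :=
        Finset.sum_congr rfl fun v' _ => Finset.sum_congr rfl fun v _ => Finset.sum_comm
    _ = ∑ v' ∈ t, ∑ γ : κ, ∑ v ∈ s, ∑ β : κ, f v β v' γ := Finset.sum_congr rfl fun v' _ => Finset.sum_comm

variable (ρ : Fin (d + 1) → ℤ) (N : ℕ)

/-- [folklore] **THE TWO SOURCE-SLOT DRESSINGS COMMUTE**: `P₂ (P₁ Y) = P₁ (P₂ Y)`. -/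
theorem coProj_snd_fst_comm (Y : Tab d) :
    (fun κ u => coProjBmAtK ρ N ((fun κ u κ' u' => coProjBmAtK ρ N (fun κ₁ u₁ => Y κ₁ u₁ κ' u') κ u) κ u))
      = fun κ u κ' u' => coProjBmAtK ρ N (fun κ₁ u₁ => (fun κ u => coProjBmAtK ρ N (Y κ u)) κ₁ u₁ κ' u') κ u := by
  funext κ u κ' u' x z a b
  simp only [coProjBmAtK_eval, coProjBmAt_apply, Finset.mul_sum]
  rw [sum_comm₄]
  exact Finset.sum_congr rfl fun _ _ => Finset.sum_congr rfl fun _ _ => Finset.sum_congr rfl fun _ _ =>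
    Finset.sum_congr rfl fun _ _ => by ring

/-- [folklore] **THE SECOND-SOURCE-SLOT DRESSING COMMUTES WITH THE FIRST-LEG DRESSING**: `P₂ (L₁ Z) = L₁ (P₂ Z)`. -/
theorem coProj_snd_legCo₁_comm (Z : Tab d) :
    (fun κ u => coProjBmAtK ρ N ((fun κ u κ' u' => legCo₁BmAt ρ N (Z κ u κ' u')) κ u))
      = fun κ u κ' u' => legCo₁BmAt ρ N ((fun κ u => coProjBmAtK ρ N (Z κ u)) κ u κ' u') := by
  funext κ u κ' u' x z a b
  rcases a with α | m
  · simp only [coProjBmAtK_eval, coProjBmAt_apply, legCo₁BmAt_inl, Finset.mul_sum]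
    rw [sum_comm₄]
    exact Finset.sum_congr rfl fun _ _ => Finset.sum_congr rfl fun _ _ => Finset.sum_congr rfl fun _ _ =>
      Finset.sum_congr rfl fun _ _ => by ring
  · simp only [coProjBmAtK_eval, coProjBmAt_apply, legCo₁BmAt_inr]

/-- [folklore] **THE SECOND-SOURCE-SLOT DRESSING COMMUTES WITH THE SECOND-LEG DRESSING**: `P₂ (L₂ Z) = L₂ (P₂ Z)`. -/
theorem coProj_snd_legCo₂_comm (Z : Tab d) :
    (fun κ u => coProjBmAtK ρ N ((fun κ u κ' u' => legCo₂BmAt ρ N (Z κ u κ' u')) κ u))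
      = fun κ u κ' u' => legCo₂BmAt ρ N ((fun κ u => coProjBmAtK ρ N (Z κ u)) κ u κ' u') := by
  funext κ u κ' u' x z a b
  rcases b with β₀ | m
  · simp only [coProjBmAtK_eval, coProjBmAt_apply, legCo₂BmAt_inl, Finset.mul_sum]
    rw [sum_comm₄]
    exact Finset.sum_congr rfl fun _ _ => Finset.sum_congr rfl fun _ _ => Finset.sum_congr rfl fun _ _ =>
      Finset.sum_congr rfl fun _ _ => by ring
  · simp only [coProjBmAtK_eval, coProjBmAt_apply, legCo₂BmAt_inr]

/-- [folklore] **THE FIRST-SOURCE-SLOT DRESSING COMMUTES WITH THE FIRST-LEG DRESSING**: `P₁ (L₁ Z) = L₁ (P₁ Z)`. -/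
theorem coProj_fst_legCo₁_comm (Z : Tab d) :
    (fun κ u κ' u' => coProjBmAtK ρ N (fun κ₁ u₁ => (fun κ u κ' u' => legCo₁BmAt ρ N (Z κ u κ' u')) κ₁ u₁ κ' u') κ u)
      = fun κ u κ' u' => legCo₁BmAt ρ N ((fun κ u κ' u' => coProjBmAtK ρ N (fun κ₁ u₁ => Z κ₁ u₁ κ' u') κ u) κ u κ' u') := by
  funext κ u κ' u' x z a b
  rcases a with α | m
  · simp only [coProjBmAtK_eval, coProjBmAt_apply, legCo₁BmAt_inl, Finset.mul_sum]
    rw [sum_comm₄]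
    exact Finset.sum_congr rfl fun _ _ => Finset.sum_congr rfl fun _ _ => Finset.sum_congr rfl fun _ _ =>
      Finset.sum_congr rfl fun _ _ => by ring
  · simp only [coProjBmAtK_eval, coProjBmAt_apply, legCo₁BmAt_inr]

/-- [folklore] **THE FIRST-SOURCE-SLOT DRESSING COMMUTES WITH THE SECOND-LEG DRESSING**: `P₁ (L₂ Z) = L₂ (P₁ Z)`. -/
theorem coProj_fst_legCo₂_comm (Z : Tab d) :
    (fun κ u κ' u' => coProjBmAtK ρ N (fun κ₁ u₁ => (fun κ u κ' u' => legCo₂BmAt ρ N (Z κ u κ' u')) κ₁ u₁ κ' u') κ u)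
      = fun κ u κ' u' => legCo₂BmAt ρ N ((fun κ u κ' u' => coProjBmAtK ρ N (fun κ₁ u₁ => Z κ₁ u₁ κ' u') κ u) κ u κ' u') := by
  funext κ u κ' u' x z a b
  rcases b with β₀ | m
  · simp only [coProjBmAtK_eval, coProjBmAt_apply, legCo₂BmAt_inl, Finset.mul_sum]
    rw [sum_comm₄]
    exact Finset.sum_congr rfl fun _ _ => Finset.sum_congr rfl fun _ _ => Finset.sum_congr rfl fun _ _ =>
      Finset.sum_congr rfl fun _ _ => by ring
  · simp only [coProjBmAtK_eval, coProjBmAt_apply, legCo₂BmAt_inr]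

/-- [folklore] **THE TWO LEG DRESSINGS COMMUTE**: `legCo₁BmAt ρ N (legCo₂BmAt ρ N V) = legCo₂BmAt ρ N (legCo₁BmAt ρ N V)` (an2's `dressKBmAt_eq_legs` fixes one order;
either order is the comp-form dressing). -/
theorem legCo₁_legCo₂_comm (V : MKer (d + 1) (Fib d)) :
    legCo₁BmAt ρ N (legCo₂BmAt ρ N V) = legCo₂BmAt ρ N (legCo₁BmAt ρ N V) := by
  funext x z a b
  rcases a with α | m <;> rcases b with β₀ | m'
  · simp only [legCo₁BmAt_inl, legCo₂BmAt_inl, coProjBmAt_apply, Finset.mul_sum]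
    rw [sum_comm₄]
    exact Finset.sum_congr rfl fun _ _ => Finset.sum_congr rfl fun _ _ => Finset.sum_congr rfl fun _ _ =>
      Finset.sum_congr rfl fun _ _ => by ring
  · simp only [legCo₁BmAt_inl, legCo₂BmAt_inr, coProjBmAt_apply]
  · simp only [legCo₁BmAt_inr, legCo₂BmAt_inl, coProjBmAt_apply]
  · simp only [legCo₁BmAt_inr, legCo₂BmAt_inr]

/-! ## §2 `𝔇` is idempotent -/

/-- [folklore] **`Πᵀ_bm` ON A STENCIL FAMILY IS A PROJECTOR** (family form of `TableDressingProjector.coProjBmAt_idem`). -/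
theorem coProjBmAtK_idem {N : ℕ} (hN : 1 ≤ N) {r : Fin (d + 1) → ℕ} (hr : r ∈ box (d + 1) N)
    (S : Fin (d + 1) → (Fin (d + 1) → ℤ) → MKer (d + 1) (Fib d)) :
    coProjBmAtK (toSite r) N (coProjBmAtK (toSite r) N S) = coProjBmAtK (toSite r) N S := by
  funext κ u x z a b
  rw [coProjBmAtK_eval, coProjBmAtK_eval]
  have e : (fun κ' u' => coProjBmAtK (toSite r) N S κ' u' x z a b) = coProjBmAt (toSite r) N (fun κ' u' => S κ' u' x z a b) := by
    funext κ' u'; rw [coProjBmAtK_eval]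
  rw [e, TableDressingProjector.coProjBmAt_idem hN hr]

/-- [folklore] **THE BOND-SLOT DRESSING COMMUTES WITH THE FIRST-LEG DRESSING OF THE VALUES** (family form): for a stencil family `S`,
`coProjBmAtK ρ N (fun κ u ↦ legCo₁BmAt ρ N (S κ u)) = fun κ u ↦ legCo₁BmAt ρ N (coProjBmAtK ρ N S κ u)`. -/
theorem coProjBmAtK_legCo₁_comm (S : Fin (d + 1) → (Fin (d + 1) → ℤ) → MKer (d + 1) (Fib d)) :
    coProjBmAtK ρ N (fun κ u => legCo₁BmAt ρ N (S κ u)) = fun κ u => legCo₁BmAt ρ N (coProjBmAtK ρ N S κ u) := by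
  funext κ u x z a b
  rcases a with α | m
  · simp only [coProjBmAtK_eval, coProjBmAt_apply, legCo₁BmAt_inl, Finset.mul_sum]
    rw [sum_comm₄]
    exact Finset.sum_congr rfl fun _ _ => Finset.sum_congr rfl fun _ _ => Finset.sum_congr rfl fun _ _ =>
      Finset.sum_congr rfl fun _ _ => by ring
  · simp only [coProjBmAtK_eval, coProjBmAt_apply, legCo₁BmAt_inr]

/-- [folklore] **THE BOND-SLOT DRESSING COMMUTES WITH THE SECOND-LEG DRESSING OF THE VALUES** (family form). -/
theorem coProjBmAtK_legCo₂_comm (S : Fin (d + 1) → (Fin (d + 1) → ℤ) → MKer (d + 1) (Fib d)) :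
    coProjBmAtK ρ N (fun κ u => legCo₂BmAt ρ N (S κ u)) = fun κ u => legCo₂BmAt ρ N (coProjBmAtK ρ N S κ u) := by
  funext κ u x z a b
  rcases b with β₀ | m
  · simp only [coProjBmAtK_eval, coProjBmAt_apply, legCo₂BmAt_inl, Finset.mul_sum]
    rw [sum_comm₄]
    exact Finset.sum_congr rfl fun _ _ => Finset.sum_congr rfl fun _ _ => Finset.sum_congr rfl fun _ _ =>
      Finset.sum_congr rfl fun _ _ => by ring
  · simp only [coProjBmAtK_eval, coProjBmAt_apply, legCo₂BmAt_inr]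

/-- [folklore] **THE BOND-SLOT DRESSING COMMUTES WITH THE KERNEL DRESSING OF THE VALUES** (family form; an2's `dressKBmAt_eq_legs` + the two leg commutations):
`coProjBmAtK ρ N (fun κ u ↦ dressKBmAt ρ N (S κ u)) = fun κ u ↦ dressKBmAt ρ N (coProjBmAtK ρ N S κ u)`. -/
theorem coProjBmAtK_dressKBmAt_comm (S : Fin (d + 1) → (Fin (d + 1) → ℤ) → MKer (d + 1) (Fib d)) :
    coProjBmAtK ρ N (fun κ u => dressKBmAt ρ N (S κ u)) = fun κ u => dressKBmAt ρ N (coProjBmAtK ρ N S κ u) := by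
  have e1 : (fun κ u => dressKBmAt ρ N (S κ u)) = fun κ u => legCo₂BmAt ρ N ((fun κ u => legCo₁BmAt ρ N (S κ u)) κ u) := by
    funext κ u; rw [dressKBmAt_eq_legs]
  rw [e1, coProjBmAtK_legCo₂_comm ρ N (fun κ u => legCo₁BmAt ρ N (S κ u)), coProjBmAtK_legCo₁_comm ρ N S]
  funext κ u
  rw [dressKBmAt_eq_legs]

/-- [folklore] **THE KERNEL DRESSING IS A PROJECTOR**: `dressKBmAt ρ N (dressKBmAt ρ N V) = dressKBmAt ρ N V` (in-block root, `1 ≤ N`; the two legs commute and each is a projector). -/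
theorem dressKBmAt_idem {N : ℕ} (hN : 1 ≤ N) {r : Fin (d + 1) → ℕ} (hr : r ∈ box (d + 1) N) (V : MKer (d + 1) (Fib d)) :
    dressKBmAt (toSite r) N (dressKBmAt (toSite r) N V) = dressKBmAt (toSite r) N V := by
  rw [dressKBmAt_eq_legs, dressKBmAt_eq_legs, legCo₁_legCo₂_comm (toSite r) N (legCo₁BmAt (toSite r) N V), legCo₁_idem hN hr,
    legCo₂_idem hN hr]

/-! ## §2 `𝔇` is idempotent -/

/-- NOT IN PRINT; OUR BOOKKEEPING.  **THE TABLE DRESSING IS A PROJECTOR**: `𝔇 (𝔇 X) = 𝔇 X` (in-block root, `1 ≤ N`, ANY table; no decay hypothesis) — the bond-slot dressing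
commutes with the kernel dressing of the values (§1), the two source-slot dressings commute (`coProj_snd_fst_comm`), and each one-variable dressing is a projector
(`TableDressingProjector`). -/
theorem tableDress_idem {N : ℕ} (hN : 1 ≤ N) {r : Fin (d + 1) → ℕ} (hr : r ∈ box (d + 1) N) (X : Tab d) :
    (fun κ u κ' u' => dressKBmAt (toSite r) N (coProjBmAtK (toSite r) N (fun κ₁ u₁ => coProjBmAtK (toSite r) N
        ((fun κ u κ' u' => dressKBmAt (toSite r) N (coProjBmAtK (toSite r) N (fun κ₁ u₁ => coProjBmAtK (toSite r) N (X κ₁ u₁) κ' u') κ u)) κ₁ u₁) κ' u') κ u))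
      = fun κ u κ' u' => dressKBmAt (toSite r) N (coProjBmAtK (toSite r) N (fun κ₁ u₁ => coProjBmAtK (toSite r) N (X κ₁ u₁) κ' u') κ u) := by
  funext κ u κ' u'
  show dressKBmAt (toSite r) N (coProjBmAtK (toSite r) N (fun κ₁ u₁ =>
      coProjBmAtK (toSite r) N (fun κ₂ u₂ => dressKBmAt (toSite r) N (coProjBmAtK (toSite r) N (fun κ₃ u₃ => coProjBmAtK (toSite r) N (X κ₃ u₃) κ₂ u₂) κ₁ u₁)) κ' u') κ u)
    = dressKBmAt (toSite r) N (coProjBmAtK (toSite r) N (fun κ₃ u₃ => coProjBmAtK (toSite r) N (X κ₃ u₃) κ' u') κ u)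
  -- (i) the second-slot dressing of the dressed slices is the dressing of the second-slot-dressed slices
  have h1 : ∀ (κ₁ : Fin (d + 1)) (u₁ : Fin (d + 1) → ℤ),
      coProjBmAtK (toSite r) N (fun κ₂ u₂ => dressKBmAt (toSite r) N (coProjBmAtK (toSite r) N (fun κ₃ u₃ => coProjBmAtK (toSite r) N (X κ₃ u₃) κ₂ u₂) κ₁ u₁)) κ' u'
        = dressKBmAt (toSite r) N (coProjBmAtK (toSite r) N (fun κ₂ u₂ => coProjBmAtK (toSite r) N (fun κ₃ u₃ => coProjBmAtK (toSite r) N (X κ₃ u₃) κ₂ u₂) κ₁ u₁) κ' u') := fun κ₁ u₁ =>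
    congrFun (congrFun (coProjBmAtK_dressKBmAt_comm (toSite r) N (fun κ₂ u₂ => coProjBmAtK (toSite r) N (fun κ₃ u₃ => coProjBmAtK (toSite r) N (X κ₃ u₃) κ₂ u₂) κ₁ u₁)) κ') u'
  simp only [h1]
  -- (ii) the same in the first slot
  have h2 : coProjBmAtK (toSite r) N (fun κ₁ u₁ => dressKBmAt (toSite r) N (coProjBmAtK (toSite r) N (fun κ₂ u₂ => coProjBmAtK (toSite r) N (fun κ₃ u₃ => coProjBmAtK (toSite r) N (X κ₃ u₃) κ₂ u₂) κ₁ u₁) κ' u')) κ u = dressKBmAt (toSite r) N (coProjBmAtK (toSite r) N (fun κ₁ u₁ => coProjBmAtK (toSite r) N (fun κ₂ u₂ => coProjBmAtK (toSite r) N (fun κ₃ u₃ => coProjBmAtK (toSite r) N (X κ₃ u₃) κ₂ u₂) κ₁ u₁) κ' u') κ u) :=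
    congrFun (congrFun (coProjBmAtK_dressKBmAt_comm (toSite r) N (fun κ₁ u₁ => coProjBmAtK (toSite r) N (fun κ₂ u₂ => coProjBmAtK (toSite r) N (fun κ₃ u₃ => coProjBmAtK (toSite r) N (X κ₃ u₃) κ₂ u₂) κ₁ u₁) κ' u')) κ) u
  rw [h2, dressKBmAt_idem hN hr]
  -- (iii) the doubly dressed source slots: `P₁ P₂ P₁ P₂ X = P₁ P₂ X`
  have h3 : ∀ (κ₁ : Fin (d + 1)) (u₁ : Fin (d + 1) → ℤ), coProjBmAtK (toSite r) N (fun κ₂ u₂ => coProjBmAtK (toSite r) N (fun κ₃ u₃ => coProjBmAtK (toSite r) N (X κ₃ u₃) κ₂ u₂) κ₁ u₁) κ' u' = coProjBmAtK (toSite r) N (fun κ₃ u₃ => coProjBmAtK (toSite r) N (X κ₃ u₃) κ' u') κ₁ u₁ := by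
    intro κ₁ u₁
    have hc := congrFun (congrFun (congrFun (congrFun (coProj_snd_fst_comm (toSite r) N (fun κ₃ u₃ => coProjBmAtK (toSite r) N (X κ₃ u₃))) κ₁) u₁) κ') u'
    refine hc.trans ?_
    show coProjBmAtK (toSite r) N (fun κ₃ u₃ => coProjBmAtK (toSite r) N (coProjBmAtK (toSite r) N (X κ₃ u₃)) κ' u') κ₁ u₁ = _
    simp only [coProjBmAtK_idem hN hr]
  simp only [h3]
  congr 1
  exact congrFun (congrFun (coProjBmAtK_idem hN hr (fun κ₃ u₃ => coProjBmAtK (toSite r) N (X κ₃ u₃) κ' u')) κ) u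


/-! ## §3 The dressed linear step sees only the dressed table -/

/-- NOT IN PRINT; OUR BOOKKEEPING.  **THE DRESSED LINEAR STEP SEES ONLY THE DRESSED TABLE** (decaying `K` at rate `m > 0`, `LocStencil₂` table at the same rate, in-block root,
`1 ≤ N`, any `c`): `lin4 c (coDressKBmAt ρ N K) N (𝔇 X) = lin4 c (coDressKBmAt ρ N K) N X` — `lin4_coDressKBmAt` twice and `tableDress_idem`. -/
theorem lin4_coDressKBmAt_tableDress {N : ℕ} (hN : 1 ≤ N) {r : Fin (d + 1) → ℕ} (hr : r ∈ box (d + 1) N)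
    {K : MKer (d + 1) (Fib d)} {C m : ℝ} (hK : Decays K C m) (hm : 0 < m) {X : Tab d} {CX : ℝ} (hX : LocStencil₂ X CX m) (c : ℝ) :
    lin4 c (coDressKBmAt (toSite r) N K) N (fun κ u κ' u' => dressKBmAt (toSite r) N
        (coProjBmAtK (toSite r) N (fun κ₁ u₁ => coProjBmAtK (toSite r) N (X κ₁ u₁) κ' u') κ u))
      = lin4 c (coDressKBmAt (toSite r) N K) N X := by
  rw [lin4_coDressKBmAt hN hr hK hm (locStencil₂_tableDress hN hr hX hm.le) c, tableDress_idem hN hr X, ← lin4_coDressKBmAt hN hr hK hm hX c]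

/-- NOT IN PRINT; OUR BOOKKEEPING.  **THE DRESSED LINEAR STEP ANNIHILATES EVERY `(𝔇 − 1)`-DEFECT** (same hypotheses): `lin4 c (coDressKBmAt ρ N K) N (𝔇 X − X) = 0` — so in the
(R-DEV) recursion the dressed transport of the forcing's first summand `𝒜^B_j ((𝔇 − 1) T_j)` reads `𝒜^B_j`, never `𝒜^E_j`, and WLOG every input of a dressed composite is a
`𝔇`-image (`TableDressingProjector` §2: its slot divergences are block means). -/
theorem lin4_coDressKBmAt_defect_eq_zero {N : ℕ} (hN : 1 ≤ N) {r : Fin (d + 1) → ℕ} (hr : r ∈ box (d + 1) N)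
    {K : MKer (d + 1) (Fib d)} {C m : ℝ} (hK : Decays K C m) (hm : 0 < m) {X : Tab d} {CX : ℝ} (hX : LocStencil₂ X CX m) (c : ℝ) :
    lin4 c (coDressKBmAt (toSite r) N K) N ((fun κ u κ' u' => dressKBmAt (toSite r) N
        (coProjBmAtK (toSite r) N (fun κ₁ u₁ => coProjBmAtK (toSite r) N (X κ₁ u₁) κ' u') κ u)) - X) = 0 := by
  have hC : 0 ≤ C := hK.nonneg (Sum.inl 0)
  obtain ⟨δ', C', hδ', -, hG⟩ := AxialDressingRooted.decays_coDressKBmAt hN hr (K := K) ⟨m, C, hm, hC, hK⟩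
  have hCX : 0 ≤ CX := hX.nonneg
  set κD : ℝ := cKb d N m * cKb d N m * (cWb d N * Real.exp (3 * m * (((d : ℝ) + 1) * N)) * cKb d N m) with hκD
  have hκD0 : 0 ≤ κD := by
    rw [hκD]
    exact mul_nonneg (mul_nonneg (cKb_nonneg _ _ _) (cKb_nonneg _ _ _))
      (mul_nonneg (mul_nonneg (cWb_nonneg _ _) (Real.exp_pos _).le) (cKb_nonneg _ _ _))
  have hD : LocStencil₂ (fun κ u κ' u' => dressKBmAt (toSite r) N
      (coProjBmAtK (toSite r) N (fun κ₁ u₁ => coProjBmAtK (toSite r) N (X κ₁ u₁) κ' u') κ u)) (κD * CX) m := by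
    have h := locStencil₂_tableDress hN hr hX hm.le
    have e : cKb d N m * cKb d N m * (cWb d N * Real.exp (3 * m * (((d : ℝ) + 1) * N)) * (cKb d N m * CX)) = κD * CX := by
      rw [hκD]; ring
    rw [e] at h
    exact h
  have b1 : ∀ κ u κ' u' x z a b, |(fun κ u κ' u' => dressKBmAt (toSite r) N
      (coProjBmAtK (toSite r) N (fun κ₁ u₁ => coProjBmAtK (toSite r) N (X κ₁ u₁) κ' u') κ u)) κ u κ' u' x z a b| ≤ (κD + 1) * CX :=
    fun κ u κ' u' x z a b => (bdd_of_locStencil₂ hD hm.le κ u κ' u' x z a b).trans (by nlinarith)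
  have b2 : ∀ κ u κ' u' x z a b, |X κ u κ' u' x z a b| ≤ (κD + 1) * CX :=
    fun κ u κ' u' x z a b => (bdd_of_locStencil₂ hX hm.le κ u κ' u' x z a b).trans (by nlinarith)
  rw [lin4_sub hG hδ' c N b1 b2, lin4_coDressKBmAt_tableDress hN hr hK hm hX c, sub_self]


/-! ## §4 The image of `𝔇`: every dressed table has BLOCK-CONSTANT divergence in each of its four variables -/

/-- NOT IN PRINT; OUR BOOKKEEPING.  **A DRESSED TABLE HAS BLOCK-CONSTANT SECOND-SOURCE-SLOT DIVERGENCE** (in-block root, `1 ≤ N`, ANY table): the `(κ′,u′)`-divergence of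
`𝔇 X` takes the same value at any two points of one block — the second-slot dressing can be moved outermost (`coProj_snd_fst_comm`, `coProjBmAtK_dressKBmAt_comm`) and a
co-projected slot carries the block mean of the divergence (`TableDressingProjector.div_coProjBmAt`). -/
theorem tableDress_div_snd_blockConst {N : ℕ} (hN : 1 ≤ N) {r : Fin (d + 1) → ℕ} (hr : r ∈ box (d + 1) N) (X : Tab d)
    (κ : Fin (d + 1)) (u x z : Fin (d + 1) → ℤ) (a b : Fib d) {p p' : Fin (d + 1) → ℤ} (hp : blk N p = blk N p') :
    ∑ β : Fin (d + 1), (dressKBmAt (toSite r) N (coProjBmAtK (toSite r) N (fun κ₁ u₁ => coProjBmAtK (toSite r) N (X κ₁ u₁) β p) κ u) x z a b - dressKBmAt (toSite r) N (coProjBmAtK (toSite r) N (fun κ₁ u₁ => coProjBmAtK (toSite r) N (X κ₁ u₁) β (p - unitVec β)) κ u) x z a b)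
      = ∑ β : Fin (d + 1), (dressKBmAt (toSite r) N (coProjBmAtK (toSite r) N (fun κ₁ u₁ => coProjBmAtK (toSite r) N (X κ₁ u₁) β p') κ u) x z a b - dressKBmAt (toSite r) N (coProjBmAtK (toSite r) N (fun κ₁ u₁ => coProjBmAtK (toSite r) N (X κ₁ u₁) β (p' - unitVec β)) κ u) x z a b) := by
  -- the dressed table, read in its second source slot, is `Πᵀ_bm` of a family
  have e : ∀ (κ₂ : Fin (d + 1)) (u₂ : Fin (d + 1) → ℤ), dressKBmAt (toSite r) N (coProjBmAtK (toSite r) N (fun κ₁ u₁ => coProjBmAtK (toSite r) N (X κ₁ u₁) κ₂ u₂) κ u)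
      = coProjBmAtK (toSite r) N (fun κ₃ u₃ => dressKBmAt (toSite r) N (coProjBmAtK (toSite r) N (fun κ₁ u₁ => X κ₁ u₁ κ₃ u₃) κ u)) κ₂ u₂ := by
    intro κ₂ u₂
    have hc := congrFun (congrFun (congrFun (congrFun (coProj_snd_fst_comm (toSite r) N X) κ) u) κ₂) u₂
    -- `hc : P₂ (P₁ X) κ u κ₂ u₂ = P₁ (P₂ X) κ u κ₂ u₂`, i.e. the inner double co-projection with the second slot outermost
    have hc' : coProjBmAtK (toSite r) N (fun κ₁ u₁ => coProjBmAtK (toSite r) N (X κ₁ u₁) κ₂ u₂) κ u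
        = coProjBmAtK (toSite r) N (fun κ₃ u₃ => coProjBmAtK (toSite r) N (fun κ₁ u₁ => X κ₁ u₁ κ₃ u₃) κ u) κ₂ u₂ := hc.symm
    rw [hc']
    exact (congrFun (congrFun (coProjBmAtK_dressKBmAt_comm (toSite r) N
      (fun κ₃ u₃ => coProjBmAtK (toSite r) N (fun κ₁ u₁ => X κ₁ u₁ κ₃ u₃) κ u)) κ₂) u₂).symm
  simp only [e, coProjBmAtK_eval]
  exact TableDressingProjector.div_coProjBmAt_blockConst hN hr _ hp

/-- NOT IN PRINT; OUR BOOKKEEPING.  **A DRESSED TABLE HAS BLOCK-CONSTANT FIRST-SOURCE-SLOT DIVERGENCE** (`coProjBmAtK_dressKBmAt_comm` + `div_coProjBmAt`). -/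
theorem tableDress_div_fst_blockConst {N : ℕ} (hN : 1 ≤ N) {r : Fin (d + 1) → ℕ} (hr : r ∈ box (d + 1) N) (X : Tab d)
    (κ' : Fin (d + 1)) (u' x z : Fin (d + 1) → ℤ) (a b : Fib d) {p p' : Fin (d + 1) → ℤ} (hp : blk N p = blk N p') :
    ∑ β : Fin (d + 1), (dressKBmAt (toSite r) N (coProjBmAtK (toSite r) N (fun κ₁ u₁ => coProjBmAtK (toSite r) N (X κ₁ u₁) κ' u') β p) x z a b - dressKBmAt (toSite r) N (coProjBmAtK (toSite r) N (fun κ₁ u₁ => coProjBmAtK (toSite r) N (X κ₁ u₁) κ' u') β (p - unitVec β)) x z a b)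
      = ∑ β : Fin (d + 1), (dressKBmAt (toSite r) N (coProjBmAtK (toSite r) N (fun κ₁ u₁ => coProjBmAtK (toSite r) N (X κ₁ u₁) κ' u') β p') x z a b - dressKBmAt (toSite r) N (coProjBmAtK (toSite r) N (fun κ₁ u₁ => coProjBmAtK (toSite r) N (X κ₁ u₁) κ' u') β (p' - unitVec β)) x z a b) := by
  have e : ∀ (κ₂ : Fin (d + 1)) (u₂ : Fin (d + 1) → ℤ), dressKBmAt (toSite r) N (coProjBmAtK (toSite r) N (fun κ₁ u₁ => coProjBmAtK (toSite r) N (X κ₁ u₁) κ' u') κ₂ u₂)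
      = coProjBmAtK (toSite r) N (fun κ₁ u₁ => dressKBmAt (toSite r) N (coProjBmAtK (toSite r) N (X κ₁ u₁) κ' u')) κ₂ u₂ := fun κ₂ u₂ =>
    (congrFun (congrFun (coProjBmAtK_dressKBmAt_comm (toSite r) N (fun κ₁ u₁ => coProjBmAtK (toSite r) N (X κ₁ u₁) κ' u')) κ₂) u₂).symm
  simp only [e, coProjBmAtK_eval]
  exact TableDressingProjector.div_coProjBmAt_blockConst hN hr _ hp

/-- NOT IN PRINT; OUR BOOKKEEPING.  **A DRESSED TABLE HAS BLOCK-CONSTANT FIRST-FIELD-LEG DIVERGENCE** (`dressKBmAt = legCo₁ ∘ legCo₂` by `legCo₁_legCo₂_comm`, then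
`TableDressingProjector.div_legCo₁_inl`). -/
theorem tableDress_div_leg₁_blockConst {N : ℕ} (hN : 1 ≤ N) {r : Fin (d + 1) → ℕ} (hr : r ∈ box (d + 1) N) (X : Tab d)
    (κ : Fin (d + 1)) (u : Fin (d + 1) → ℤ) (κ' : Fin (d + 1)) (u' z : Fin (d + 1) → ℤ) (b : Fib d) {p p' : Fin (d + 1) → ℤ} (hp : blk N p = blk N p') :
    ∑ β : Fin (d + 1), (dressKBmAt (toSite r) N (coProjBmAtK (toSite r) N (fun κ₁ u₁ => coProjBmAtK (toSite r) N (X κ₁ u₁) κ' u') κ u) p z (Sum.inl β) b - dressKBmAt (toSite r) N (coProjBmAtK (toSite r) N (fun κ₁ u₁ => coProjBmAtK (toSite r) N (X κ₁ u₁) κ' u') κ u) (p - unitVec β) z (Sum.inl β) b)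
      = ∑ β : Fin (d + 1), (dressKBmAt (toSite r) N (coProjBmAtK (toSite r) N (fun κ₁ u₁ => coProjBmAtK (toSite r) N (X κ₁ u₁) κ' u') κ u) p' z (Sum.inl β) b - dressKBmAt (toSite r) N (coProjBmAtK (toSite r) N (fun κ₁ u₁ => coProjBmAtK (toSite r) N (X κ₁ u₁) κ' u') κ u) (p' - unitVec β) z (Sum.inl β) b) := by
  rw [dressKBmAt_eq_legs, ← legCo₁_legCo₂_comm, TableDressingProjector.div_legCo₁_inl hN hr, TableDressingProjector.div_legCo₁_inl hN hr, hp]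

/-- NOT IN PRINT; OUR BOOKKEEPING.  **A DRESSED TABLE HAS BLOCK-CONSTANT SECOND-FIELD-LEG DIVERGENCE** (`dressKBmAt_eq_legs` + `TableDressingProjector.div_legCo₂_inl`). -/
theorem tableDress_div_leg₂_blockConst {N : ℕ} (hN : 1 ≤ N) {r : Fin (d + 1) → ℕ} (hr : r ∈ box (d + 1) N) (X : Tab d)
    (κ : Fin (d + 1)) (u : Fin (d + 1) → ℤ) (κ' : Fin (d + 1)) (u' x : Fin (d + 1) → ℤ) (a : Fib d) {p p' : Fin (d + 1) → ℤ} (hp : blk N p = blk N p') :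
    ∑ β : Fin (d + 1), (dressKBmAt (toSite r) N (coProjBmAtK (toSite r) N (fun κ₁ u₁ => coProjBmAtK (toSite r) N (X κ₁ u₁) κ' u') κ u) x p a (Sum.inl β) - dressKBmAt (toSite r) N (coProjBmAtK (toSite r) N (fun κ₁ u₁ => coProjBmAtK (toSite r) N (X κ₁ u₁) κ' u') κ u) x (p - unitVec β) a (Sum.inl β))
      = ∑ β : Fin (d + 1), (dressKBmAt (toSite r) N (coProjBmAtK (toSite r) N (fun κ₁ u₁ => coProjBmAtK (toSite r) N (X κ₁ u₁) κ' u') κ u) x p' a (Sum.inl β) - dressKBmAt (toSite r) N (coProjBmAtK (toSite r) N (fun κ₁ u₁ => coProjBmAtK (toSite r) N (X κ₁ u₁) κ' u') κ u) x (p' - unitVec β) a (Sum.inl β)) := by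
  rw [dressKBmAt_eq_legs, TableDressingProjector.div_legCo₂_inl hN hr, TableDressingProjector.div_legCo₂_inl hN hr, hp]

end Summit.QuantumFields.BalabanUV.Beta.GAN24.TableDressingIdempotent

end
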